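import Literature.AlgebraicGeometry.HodgeTheory.ComplexTorusIntegralHodgeClassesPontryaginProduct
import HarnessLib

/-!
# Poincaré duality carries the Pontryagin product of integral Hodge classes to the Pontryagin product of cycles: `(x ⋆ y) ∩ [X] = (x ∩ [X]) ⋆ (y ∩ [X])`

Sequel of g31-#4 (`ComplexTorusIntegralHodgeClassesPontryaginProduct`: `x ⋆ y := μ_*(x ⊠ y)` on `Hdg•(X, ℤ)`). Lange defines the Pontryagin product FIRST on the
homology `H_•(X, ℤ) = ⋀• Λ` of the torus `X = V/Λ` (§2.5.3: "`⋆ : H_p(X,ℤ) × H_q(X,ℤ) →^{×} H_{p+q}(X × X,ℤ) →^{μ_*} H_{p+q}(X,ℤ)`" — in the tree p09's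
`ComplexTorus.pontryagin σ τ` on `⋀[ℤ]• (ι → ℤ)` with `homologyMap_addMatrix_crossCycle : μ_*(σ × τ) = σ ⋆ τ`) and then on Chow groups "in the same way as for
homology groups" (§6.2.3), the two being compatible through the cycle map; on cohomology `f_*` IS `D_Y ∘ H_•(f) ∘ (− ∩ [X])` (Bredon's `f^! = D_M f_* D_N⁻¹`, the
definition of g27-#2's push-forward). THIS file records the resulting compatibility — a validation of g31-#4's definition against the homology Pontryagin
product held in the tree: for `x ∈ Hdgᵖ(X, ℤ)`, `y ∈ Hdg^q(X, ℤ)` with Poincaré dual cycles `x ∩ [X] ∈ H_{2g−2p}(X, ℤ)`, `y ∩ [X] ∈ H_{2g−2q}(X, ℤ)`,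

* §1 **`homologyCapMap_pontryagin_fundamentalClass`** — `(x ⋆ y) ∩ [X] = (x ∩ [X]) ⋆ (y ∩ [X])` in `H_{l_x + l_y}(X, ℤ)` (stated on Q1708's `H_•(X, ℤ) = Hom(H•, ℤ)`
  through the period embedding `cyclePeriod`): `(μ_*(x ⊠ y)) ∩ [X] = μ_*((x ⊠ y) ∩ [X × X])` (g27-#7 `homologyCapMap_integralHodgeClassesPushforward_fundamentalClass`),
  `(x ⊠ y) ∩ [X × X] = (x ∩ [X]) × (y ∩ [X])` (g27-#7 `homologyCapMap_integralHodgeClassesCross_fundamentalClass`, Lange Lemma 2.5.12 / Cor. 2.5.17), and `μ_*(σ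
  × τ) = σ ⋆ τ` (p09);
* §2 **`capProduct_pontryagin_fundamentalCycle`** — the same at the level of cycles `⋀[ℤ]^{l}(Λ)` (periods are injective, g18 `cyclePeriod_injective`).

Everything is proved; no definition and no named fact is introduced (D-0026).

## References
* [Lange2023AbelianVarietiesComplex] H. Lange, Abelian Varieties over the Complex Numbers, Springer 2023, §2.5.3 (p0132 L17–L23: `⋆ = μ_* ∘ ×` on `H_•(X, ℤ)`),
  Lemma 2.5.12, Cor. 2.5.17 (p0133–p0134), §6.2.3 (p0308 L3–L7: "defined in the same way as for homology groups").
* [Bredon1993] G. E. Bredon, Topology and Geometry, Springer 1993, Ch. VI §11 Def. 11.2 (p0376 L13–L27: `f^! = D_M f_* D_N⁻¹`), §14 Prop. 14.1 (p0402).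
* [Fulton1998] W. Fulton, Intersection Theory, 2nd ed., Springer 1998, §1.10 Prop. 1.10 (b)(i) (p0035 L20–L27), §19.1 (p0372 L26–L30).
-/

noncomputable section

open CategoryTheory Function

namespace Literature.AlgebraicGeometry.HodgeTheory

open Literature.AlgebraicGeometry.Motives Literature.AlgebraicGeometry.Motives.HodgeStructure
open Literature.Geometry.Kaehler Literature.Geometry.Kaehler.ComplexTorus

namespace ComplexTorusCat

section Duality

variable (X : ComplexTorusCat) [LinearOrder X.toIsog.ι] {g G : ℕ} (eX : Fin (2 * g) ≃ X.toIsog.ι) (e₂ : Fin (2 * G) ≃ (prodObj X X).toIsog.ι)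
  (hg : g + g = 2 * g) (hG : G + G = 2 * G) (hgG : g + g = G) {p q r r' lx ly : ℕ} (hpq : p + q = r) (hx : lx + 2 * p = 2 * g) (hy : ly + 2 * q = 2 * g)
  (hl : (lx + ly) + 2 * r = 2 * G) (hl' : (lx + ly) + 2 * r' = 2 * g)

include hgG in
/-- **`(x ⋆ y) ∩ [X] = (x ∩ [X]) ⋆ (y ∩ [X])` IN `H_{l_x + l_y}(X, ℤ)`** for `x ∈ Hdgᵖ(X, ℤ)`, `y ∈ Hdg^q(X, ℤ)` (`l_x = 2g − 2p`, `l_y = 2g − 2q` the dimensions of the dual cycles):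
Poincaré duality `− ∩ [X]` carries g31-#4's Pontryagin product `x ⋆ y = μ_*(x ⊠ y)` of integral Hodge classes to Lange's Pontryagin product `σ ⋆ τ = μ_*(σ × τ)` of
homology classes (p09's `pontryagin` on `⋀[ℤ]• Λ`), the two products being "defined in the same way": `μ_*(x ⊠ y) ∩ [X] = μ_*((x ⊠ y) ∩ [X × X]) = μ_*((x ∩ [X]) ×
(y ∩ [X])) = (x ∩ [X]) ⋆ (y ∩ [X])` (`f_*γ ∩ [Y] = f_*(γ ∩ [X])`, `(γ ⊠ δ) ∩ [X × Z] = (γ ∩ [X]) × (δ ∩ [Z])`, g27-#7; `μ_*(σ × τ) = σ ⋆ τ`, p09). Stated on `H_•(X, ℤ)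
⊂ Hom(H•(X, ℚ), ℚ)` through the period map of cycles, in the frame `eX` (any frame `e₂` of `X × X`). [cite: Lange2023AbelianVarietiesComplex, §2.5.3 (p0132 L17–L21)
and §6.2.3 (p0308 L3–L5)] [cite: Bredon1993, Ch. VI §11 Def. 11.2 (p0376 L13–L18)] [cite: Fulton1998, §1.10 Prop. 1.10 (b)(i) (p0035 L20–L27)] -/
theorem homologyCapMap_pontryagin_fundamentalClass (x : integralHodgeClasses X.toIsog.Φ p) (y : integralHodgeClasses X.toIsog.Φ q) :
    homologyCapMap X hl'
        (((intHodgeClassesAddEquivIntegralHodgeClasses X r').symm (integralHodgeClassesPontryagin X eX e₂ hg hG hpq hl hl' x y) :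
            (HkIntObj X (2 * r')).intHodgeClasses r') : rationalForms X.toIsog.Φ (2 * r'))
        ((fundamentalClass X eX : (HₖIntObj X (2 * g)).Λ) : (HₖIntObj X (2 * g)).V) =
      ((cyclePeriod X (lx + ly)
          (pontryagin
            (capProduct X.toIsog.Φ hx ⟨(x : X.toIsog.E [⋀^Fin (2 * p)]→L[ℝ] ℂ), ((mem_integralHodgeClassesIn_iff_mem_hodgeClassesIn X.toIsog.Φ).1 x.2).2⟩
              (fundamentalCycle X.toIsog.Φ eX))
            (capProduct X.toIsog.Φ hy ⟨(y : X.toIsog.E [⋀^Fin (2 * q)]→L[ℝ] ℂ), ((mem_integralHodgeClassesIn_iff_mem_hodgeClassesIn X.toIsog.Φ).1 y.2).2⟩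
              (fundamentalCycle X.toIsog.Φ eX))) : (HₖIntObj X (lx + ly)).Λ) : (HₖIntObj X (lx + ly)).V) := by
  rw [integralHodgeClassesPontryagin_apply,
    integralHodgeClassesPushforward_eq_of_enum' r r' (addHom X) (show 2 * G = 2 * g + 2 * g by omega) rfl e₂ (sumEnum eX eX) eX eX hl hG hl' hg
      (show (lx + ly) + 2 * r = 2 * g + 2 * g by omega) (show G + G = 2 * g + 2 * g by omega) hl' hg,
    homologyCapMap_integralHodgeClassesPushforward_fundamentalClass (addHom X) (sumEnum eX eX) eX (show (lx + ly) + 2 * r = 2 * g + 2 * g by omega)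
      (show G + G = 2 * g + 2 * g by omega) hl' hg,
    homologyCapMap_integralHodgeClassesCross_fundamentalClass X X eX eX hx hy hpq, HₖIntMap_cyclePeriod, addHom_val, homologyMap_addMatrix_crossCycle]

include hgG in
/-- **`(x ⋆ y) ∩ {X} = (x ∩ {X}) ⋆ (y ∩ {X})` AT THE LEVEL OF CYCLES `⋀[ℤ]• Λ`** (`{X}` the fundamental cycle in the frame `eX`; the periods `⋀[ℤ]^l Λ → H_l(X, ℤ)` are
injective): the cycle Poincaré dual to `x ⋆ y` is the Pontryagin product of the cycles dual to `x` and `y`. [cite: Lange2023AbelianVarietiesComplex, §2.5.3 (p0132 L17–L21)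
and Lemma 2.5.12 (p0133)] [cite: Bredon1993, Ch. VI §11 Def. 11.2 (p0376 L13–L18)] -/
theorem capProduct_pontryagin_fundamentalCycle (x : integralHodgeClasses X.toIsog.Φ p) (y : integralHodgeClasses X.toIsog.Φ q) :
    capProduct X.toIsog.Φ hl'
        ⟨((integralHodgeClassesPontryagin X eX e₂ hg hG hpq hl hl' x y : integralHodgeClasses X.toIsog.Φ r') : X.toIsog.E [⋀^Fin (2 * r')]→L[ℝ] ℂ),
          ((mem_integralHodgeClassesIn_iff_mem_hodgeClassesIn X.toIsog.Φ).1 (integralHodgeClassesPontryagin X eX e₂ hg hG hpq hl hl' x y).2).2⟩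
        (fundamentalCycle X.toIsog.Φ eX) =
      pontryagin
        (capProduct X.toIsog.Φ hx ⟨(x : X.toIsog.E [⋀^Fin (2 * p)]→L[ℝ] ℂ), ((mem_integralHodgeClassesIn_iff_mem_hodgeClassesIn X.toIsog.Φ).1 x.2).2⟩
          (fundamentalCycle X.toIsog.Φ eX))
        (capProduct X.toIsog.Φ hy ⟨(y : X.toIsog.E [⋀^Fin (2 * q)]→L[ℝ] ℂ), ((mem_integralHodgeClassesIn_iff_mem_hodgeClassesIn X.toIsog.Φ).1 y.2).2⟩
          (fundamentalCycle X.toIsog.Φ eX)) := by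
  have h1 := homologyCapMap_pontryagin_fundamentalClass X eX e₂ hg hG hgG hpq hx hy hl hl' x y
  have hv : (((intHodgeClassesAddEquivIntegralHodgeClasses X r').symm (integralHodgeClassesPontryagin X eX e₂ hg hG hpq hl hl' x y) :
      (HkIntObj X (2 * r')).intHodgeClasses r') : rationalForms X.toIsog.Φ (2 * r')) ∈ integralKForms X.toIsog.Φ (2 * r') :=
    (mem_integralKForms_iff _ _).2 ((mem_integralHodgeClassesIn_iff_mem_hodgeClassesIn X.toIsog.Φ).1 (integralHodgeClassesPontryagin X eX e₂ hg hG hpq hl hl' x y).2).2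
  rw [fundamentalClass_def, homologyCapMap_cyclePeriod X hl' hv] at h1
  exact cyclePeriod_injective X (lx + ly) (Subtype.coe_injective h1)

end Duality

end ComplexTorusCat

end Literature.AlgebraicGeometry.HodgeTheory
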